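import Summits.QuantumFields.BalabanUV.T4Continuum.Support.B13StepOfRecordSubstrateShift
import Summits.QuantumFields.BalabanUV.T4Continuum.Support.B13StepEndInsOpBalaban
import Summits.QuantumFields.BalabanUV.T4Continuum.Support.SubstrateO1ReadingsShift

/-!
# B13StepOfRecordSubstrateShiftBalaban — NE5 ∕ U3: E8[rec] (THE STRUCTURAL SECANT END OF RECORD) AT THE SUBSTRATE's **COV-SHIFTED** O1 INSTANCE
# `SubstrateSlotsOfRecordShift.slotsOfRecordShift …` (W-21 = L-E15, p234583) WITH W1 PRODUCED AT BAŁABAN's TIER-B BACKGROUND IN THE WINDOWED READING SHAPES —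
# `B13StepOfRecordSubstrateShift` §1 ∕ §2 with the `hwer` binder SUPPLIED by substrate-p1's W-21b = L-E9b `SubstrateO1ReadingsShift` BY NAME and `hc₁ ∕ hθ0`
# discharged (`B13StepEndInsOpBalaban` §1, p225077); the twin of p228385 that SUPERSEDES its F-ne5p1-g37-1 flag (NE5 owner R53 ∕ R54 ∕ R55 ∕ R56)

Cell `pub-balaban`, unit `b2b-balaban-t4-ne5-formalise-leaf-01` (NE5 formalisation swarm, LEAF PROVER 01, gen 19; typer `t4/formal/NE5/LEAVES.md` v2.9
CLAIM RULE 7 (b) ∕ CLAIM RULE 1; journal `HOME/CLAIMS.log` l.20460 «GO (b′)» ∕ ONLINE+INTENT gen 19).  A FOLLOWER of this lineage's E8[rec] faces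
(`B13StepOfRecordSecantStructural` p214566 → `…On` p216836 → `…Sub` p217039 → `…Uniform` p219431 → `B13StepOfRecordSubstrate` p221190 → `…SubstrateBalaban`
p228385 → `B13StepOfRecordSubstrateShift` (gen 19)).  GENERATED MECHANICALLY from the TREE bytes of p228385 (generator `gen_shift2.py` in the unit's HOME dir):
imports ∕ opens re-pointed (`B13StepOfRecordSubstrate ↦ B13StepOfRecordSubstrateShift` + leaf-08-g13's `B13StepOfRecordSubstrateShiftLetters`,
`SubstrateO1Readings ↦ SubstrateO1ReadingsShift`, `+ SubstrateSlotsOfRecordShift`, `+ B13ReadingsLevelWindow (ReadsTowerCovAOn ReadsTowerCovBOn)`), the instance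
`slotsOfRecord … ↦ slotsOfRecordShift …`, run B's raw record `rawBOfRecord ιr D … ↦ rawBOfRecordShift D ιr …` (inside `hbdB hcovB hΔB hΓB hQ hR`), the letter
lemmas `opA∕opB_mem_measOp_slotsOfRecord ↦ …Shift`, and the two covariance readings RE-DISPLAYED IN W-21b's FINAL WINDOWED SHAPE
`hcovA : ReadsTowerCovAOn {k : ℕ | k ≤ D.K} …` ∕ `hcovB : ReadsTowerCovBOn {k : ℕ | k ≤ D.K} …` (owner g37-c `B13ReadingsLevelWindow` BY NAME; R55 (R-i) ∕ typer
T-S19: above run A's top the record's cov slots are junk — W-21b DISCHARGES the off-window agreement `hoff` inside); every other byte of p228385's statement and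
proof UNCHANGED (one positional application of `B13StepOfRecordSubstrateShift.ne5_of_substrateShift_restrict_secant_structural` with `hwer :=`
`SubstrateO1ReadingsShift.weightedEntrywiseRate_slotsOfRecordShift_balaban_ne3Shape …`).  p228385 STAYS in the tree as the record of the UNSHIFTED instance
(no deletion, no v1.1; R54 (4): the flag is lifted by RE-POINTING, not by prose).  Imports `B13StepOfRecordSubstrateShift` + `B13StepEndInsOpBalaban` (§1 lemmas
only) + `SubstrateO1ReadingsShift`; edits nothing; defines NO species reading (R41) and constructs ∕ discharges NOTHING of the instance (R34) beyond the by-name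
readings listed below.  Summits-side new work under the LEAN PLACEMENT RULE (bookkeeping; 0 `def`, 0 cite tags — printed KIND only).
WHY THE SHIFT (R53 ∕ F-ne5p1-g37-1 ∕ kernel fact K8, journal l.19772 ∕ l.19805): p228385 displays `hcovA : ReadsTowerCovA … (rawAOfRecord … ∘ transport)` ∧
`hcovB : ReadsTowerCovB … (rawBOfRecord …)` at the UNSHIFTED slots, where run B's cov slot at aligned index `k` reads the SAME depth as run A's — a pair jointly
inhabitable only by towers whose level increment on read entries is the `ΓB`-vs-`ΓA` letter variation (level-CONSTANT at common `Γ`), NOT rows NE2 ∧ NE3's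
towers (a correct composition with a docstring-level vacuity flag).  HERE run B's cov slot reads its tower of record ONE LEVEL DEEPER (W-21 (α)) and both
readings are WINDOWED to run A's levels; the pair is inhabited by the substrate's own one-datum tower (W-21 §3 `readsTowerCovB_shift` ∕ `readsTowerCovA_record_of_le`;
junction J-cov to row NE2's `pertCovC` tower through `tow ∕ RgV ∕ σ` stays displayed, inhabited by nobody here).
HONEST FRAMING: rung (B)+1 of the FINITE-VOLUME T⁴ continuum programme — NOT infinite volume, NOT a mass gap, NOT the Clay problem, and **NOT A PROOF OF
NE5** (NOT PRINTED: the series prints ε-UNIFORM bounds, never η-RATES; cell GAPS G-t4-U3-1), NOT a proof of NE2 or NE3: every theorem is an IMPLICATION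
whose wall binders are DISPLAYED HYPOTHESES — about the SUBSTRATE's LETTERS (`SlotLetters`: factor letters, weights `W`, contour systems `ΓA ∕ ΓB`, kernel ∕
potential tables `dkA … pRB`, insertion letters `ins`, margins `rOp ∕ rHist`), U1b's `NE3Shape` (OPEN, row NE3), the (3.35)-class ∕ threshold letters and
the owner's O1 reading ∕ decay ∕ Lipschitz ∕ domination letters AT THE SUBSTRATE's TABLES — asserted nowhere; the substrate's instance is NOT claimed to
satisfy any of them.  W1 is thereby RELOCATED (from a displayed `hwer` to `NE3Shape` + letters), NOT discharged; W1-cov of record = rows NE2 ∧ NE3's TWO-LEVEL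
tower rate at the related background (R53 (3)).  R48 ∕ R49 HONEST LINE: `slotsOfRecordShift` is the VALUE-TABLE model (poorer than print at MI-R,
[Balaban1988RG2Cluster] Lemma 1 (1.33)); Road D `OutputRateFunctionalTables*` is of record for MI-R, instance = substrate; VALUE UNCHANGED.  HONEST DEPENDENCY
(cell line, verbatim): continuum YM on T⁴ ⇐ BetaPertH ∧ nine spine estimates (0/9 proved); BetaPertH ⇐ (D1) ∧ (D4) ∧ CAP+tail; G-an2-4 gates asym, D1 and
NE2/3/4.

WHAT THIS FILE DOES (compositions BY NAME; no analytic estimate of its own).  At `S₀ := slotsOfRecordShift D ιr cc ag sg Pm 𝒵 domZ Jc Vv mI Lsl` two binders of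
`B13StepOfRecordSubstrateShift.ne5_of_substrateShift_restrict_secant_structural` are READ BY NAME: (i) W1 `hwer : WeightedEntrywiseRate S₀.F (assembly S₀).rawAt
S₀.rawB W c₁ (fun k => θ ^ k)` := substrate-p1's `SubstrateO1ReadingsShift.weightedEntrywiseRate_slotsOfRecordShift_balaban_ne3Shape` (the owner's WINDOWED record
face `B13ReadingsRecordWindow.weightedEntrywiseRate_record_balaban_ne3Shape_on` AT the shifted instance, `Scov := {k | k ≤ D.K}`, `hoff` discharged there) — so
U1b's `NE3Shape (minActReadings …) C θ` (OPEN), the class ∕ threshold letters `hL hd hreg hα hβ hC ha′ hαη hβη hη` and the owner's O1 letters AT THE SUBSTRATE's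
TABLES `hdec hcovA hcovB hdom₁ hΦ hΛ₂ hS₂ hdecΦ hΔA hΔB hdom₂ hΨ hΛ₃ hS₃ hdecΨ hΓA hΓB hdom₃ hΛ₄ hΛ₅ hQ hR` are displayed instead (run A read THROUGH THE
TRANSPORTER, run B's raw record = `rawBOfRecordShift D ιr …`, `hcovA ∕ hcovB` WINDOWED), the W1 rate becoming `√(max θ L⁻¹)` and the W1 constant
`c₁ := √(2B₁(2·CpertRec∕(1 − max θ L⁻¹))) + √(2B₂Λ₂CpertRec) + √(2B₃Λ₃CpertRec) + Λ₄C + Λ₅C`; (ii) `hc₁ ∕ hθ0` := leaf-10's p225077 §1 (`c1_balaban_nonneg`,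
`(sqrt_rate_pos_lt_one … hNE3.rate_lt_one).1`).  EVERY OTHER binder is displayed VERBATIM at the two substitutions `θ ↦ √(max θ L⁻¹)`, `c₁ ↦` the W1 constant
(the Letters module's §1 letter conditions `hbdA hmQA hmRA hbdB hmQB hmRB`, its §2 factorisation datum `(iopAt, hiopA)`, W3 slice budgets, L05 ∕ L06,
`RawBounded` ×2, floor, `InsOpComposition` + `hIA` + `InsOpRate`, the W2-op binder `ActOpFibre` + op-activity letters, the history-side `ActExpLinearOn` ∕
`ActExpNormBound` ∕ `ActAbsBound` over `↥measOp` + activity letters, rooms, signs, the arithmetic letters `k₀ B ρ₀ ρ₁ k₁ E₁ hfirst hreach hreachI`,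
`√(max θ L⁻¹) ≤ θ′ ≤ 1`, `hsmall`).  Renames as in p228385 (no content): `Φ ↦ Φc` (insertion-composition map), `hdec ↦ hdecAct` (activity decay split),
`N ↦ Nl` (NE3's level count).
* §1 **`ne5_of_substrateShift_restrict_secant_structural_balaban_ne3Shape`** — PER TWO-RUN OBJECT `D : DrivenRuns 𝔾` and letter package `Lsl`: conclusion
  LITERALLY `T4OutputRate.NE5 (B13StepOfRecord.outA (slotsOfRecordShift …) E₀ cB) (B13StepOfRecord.outB (slotsOfRecordShift …) E₀ cB) W κ θ′ C₅` with p214566's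
  `C₅` at the two substitutions.
* §2 (companion module `B13StepOfRecordSubstrateShiftBalabanUniform`, split for the 400-line rule) **`uniform_ne5_of_substrateShift_restrict_secant_structural_balaban_ne3Shape`**
  — ONE `C₅` from the SIZES ONLY for EVERY gauge group, driven two-run object, letters, frame, factor index data, letter package, admissible data, towers, O1
  letters, window, radii ∕ majorants ∕ datum ∕ insertion-composition data (quantifier order `∃ C₅, ∀ 𝔾 D … Lsl …`).
CENSUS vs p228385 §1 (binders, by name): MINUS = ∅; PLUS = ∅; TYPE changes = the instance `slotsOfRecordShift`, run B's raw record `rawBOfRecordShift D ιr …` in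
`hbdB ∕ hcovB ∕ hΔB ∕ hΓB ∕ hQ ∕ hR`, and `hcovA ∕ hcovB` windowed (`ReadsTowerCovAOn ∕ ReadsTowerCovBOn {k : ℕ | k ≤ D.K}`) — exactly leaf-08-g13's S2a and
leaf-03-g16's E9-S2 lists for their roads.  CENSUS vs `B13StepOfRecordSubstrateShift` §1: MINUS = [hwer, hc₁, hθ0] (+ the free letters `c₁`, `θ` now terms);
PLUS = [the NE3 tower letters `L M a ha` (+ `d o m α β C a′ η`), `𝒞 Nl dom RgV hL hd hreg hα hβ hC θ hNE3 ha′ hαη hβη hη tow σ dist₁ B₁ δ₁ hdec hcovA hcovB hdom₁ S₂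
Φ Λ₂ hΦ hΛ₂ hS₂ dist₂ B₂ δ₂ hdecΦ σX hΔA hΔB hdom₂ S₃ Ψ Λ₃ hΨ hΛ₃ hS₃ dist₃ B₃ δ₃ hdecΨ σB hΓA hΓB hdom₃ Λ₄ Λ₅ hΛ₄ hΛ₅ hQ hR`]; RENAMED = [Φ ↦ Φc, hdec ↦ hdecAct];
rest IDENTICAL (specialised).  Headline wording (trigger c5 ∕ referee INFO-38): «END ⇐ instance letters», never «leaf instantiated»; 0∕12 leaves on Bałaban's
concrete objects; spine 0∕9.  `FlowStep.BetaPertH`, (B), (B^μ) do not occur.  0 sorry; axioms ⊆ {propext, Classical.choice, Quot.sound}.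
-/

noncomputable section

open scoped BigOperators ComplexConjugate Matrix Matrix.Norms.L2Operator Kronecker
open Metric Set MeasureTheory

namespace Summit.QuantumFields.BalabanUV.T4Continuum.B13StepOfRecordSubstrateShiftBalaban

open Literature.MathematicalPhysics.QuantumFieldTheory.Balaban1983to89
open Literature.MathematicalPhysics.QuantumFieldTheory.Balaban1983to89.T4OutputRate (DecayBound NE5)
open Literature.MathematicalPhysics.QuantumFieldTheory.Balaban1983to89.T4InputCauchyRateSpecies (ballClass)
open Literature.MathematicalPhysics.QuantumFieldTheory.Balaban1983to89.B5Prop11Plancherel (Cst Cst_nonneg Tor fine)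
open Literature.MathematicalPhysics.QuantumFieldTheory.Balaban1983to89.B5G183RateUnitTower (lev lev_neZero)
open Literature.MathematicalPhysics.QuantumFieldTheory.Balaban1983to89.T4EtaRateMin (LocalRate NE3Shape)
open Summit.QuantumFields.BalabanUV.T4Continuum
open Summit.QuantumFields.BalabanUV.T4Continuum.B13Carriers (TwoRuns)
open Summit.QuantumFields.BalabanUV.T4Continuum.B13OpDatum (OpDatum Species FormatBounded B13Weights)
open Summit.QuantumFields.BalabanUV.T4Continuum.B13OpDatumJunctions (opOf RawBounded WeightedEntrywiseRate)
open Summit.QuantumFields.BalabanUV.T4Continuum.B13OpMeasurable (measOp)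
open Summit.QuantumFields.BalabanUV.T4Continuum.B13HistMeasurable (MeasPotFrame B13HistM)
open Summit.QuantumFields.BalabanUV.T4Continuum.B13StepTermLabels (InnerLabel)
open Summit.QuantumFields.BalabanUV.T4Continuum.B13StepTermFamily (ActData ActExpLinearOn)
open Summit.QuantumFields.BalabanUV.T4Continuum.B13StepTermSocket (labelsIndexing)
open Summit.QuantumFields.BalabanUV.T4Continuum.B13InnerData (Bnd b13InnerData)
open Summit.QuantumFields.BalabanUV.T4Continuum.UrsellTermBudget (actSum)
open Summit.QuantumFields.BalabanUV.T4Continuum.B13TermHistSecant (ActExpNormBound ActAbsBound)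
open Summit.QuantumFields.BalabanUV.T4Continuum.B13DomainGeometryTR (domainGeometry)
open Summit.QuantumFields.BalabanUV.T4Continuum.B13Base (selfCtr)
open Summit.QuantumFields.BalabanUV.T4Continuum.B13StepOfRecord (Slots assembly step)
open Summit.QuantumFields.BalabanUV.T4Continuum.OutputRateActOpFibre (ActOpFibre)
open Summit.QuantumFields.BalabanUV.T4Continuum.OutputRateInsertionStructural (InsOpComposition)
open Summit.QuantumFields.BalabanUV.T4Continuum.B13StepOfRecordSub (assemblyOn stepOn restrict opA_mem_measOp opB_mem_measOp)
open Summit.QuantumFields.BalabanUV.T4Continuum.B13StepOfRecordSubstrateShiftLetters (opA_mem_measOp_slotsOfRecordShift opB_mem_measOp_slotsOfRecordShift)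
open Summit.QuantumFields.BalabanUV.T4Continuum.B13StepOfRecordSubstrateShift (ne5_of_substrateShift_restrict_secant_structural
  uniform_ne5_of_substrateShift_restrict_secant_structural)
open Summit.QuantumFields.BalabanUV.T4Continuum.B13StepEndInsOpBalaban (sqrt_rate_pos_lt_one c1_balaban_nonneg)
open Summit.QuantumFields.BalabanUV.T4Continuum.B13ReadingsDecay (CovWeightDominatesDist)
open Summit.QuantumFields.BalabanUV.T4Continuum.B13ReadingsLevelWindow (ReadsTowerCovAOn ReadsTowerCovBOn)
open Summit.QuantumFields.BalabanUV.T4Continuum.B13ReadingsImage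
open Summit.QuantumFields.BalabanUV.T4Continuum.B13ReadingsLocal (PotQLipschitzReading PotRLipschitzReading)
open Summit.QuantumFields.BalabanUV.T4Continuum.B13ReadingsAssembly (CpertRec)
open Summit.QuantumFields.BalabanUV.T4Continuum.SubstrateO1ReadingsShift (weightedEntrywiseRate_slotsOfRecordShift_balaban_ne3Shape)
open Summit.QuantumFields.BalabanUV.T4Continuum.DecayRateInterpolation (EntryDecay)
open Summit.QuantumFields.BalabanUV.T4Continuum.CovariantBlockAveraging (ContourSystem)
open Summit.QuantumFields.BalabanUV.T4Continuum.SubstrateBackgroundTransporters (unitMod)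
open Summit.QuantumFields.BalabanUV.T4Continuum.SubstrateTwoRunsDriven (DrivenRuns)
open Summit.QuantumFields.BalabanUV.T4Continuum.SubstrateRawSpecies
open Summit.QuantumFields.BalabanUV.T4Continuum.SubstrateSlotsOfRecord
open Summit.QuantumFields.BalabanUV.T4Continuum.SubstrateSlotsOfRecordShift
open Summit.QuantumFields.BalabanUV.T4Continuum.BalabanAveragedTowerUnit (idx Qlev)
open Summit.QuantumFields.BalabanUV.T4Continuum.GaugeTermScalarData (QuT Q1)
open Summit.QuantumFields.BalabanUV.T4Continuum.RegularSiteTransporters (siteT)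
open Summit.QuantumFields.BalabanUV.T4Continuum.RegularBackgroundTower (RegularTransporters)
open Summit.QuantumFields.BalabanUV.T4Continuum.NE2ColourPerturbedLayer (pertCovC)
open Summit.QuantumFields.BalabanUV.T4Continuum.NE2BalabanRoot (balabanPert)
open Summit.QuantumFields.BalabanUV.T4Continuum.NE2BalabanGauge (gaugeSlot liftR)
open Summit.QuantumFields.BalabanUV.T4Continuum.NE2BalabanThreshold (etaStar)
open Summit.QuantumFields.BalabanUV.T4Continuum.NE2FromNE3Carrier (ne2Loc)
open Summit.QuantumFields.BalabanUV.T4Continuum.MinimalActionRate (minActReadings)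

/-! ## §1 E8[rec] of record at the substrate's O1 instance, W1 produced at Bałaban's tier-B background -/

section Instance

-- the substrate's telescope for `slotsOfRecordShift` (W-21; same letters as p220104 §SlotsRecord, names as in `SubstrateO1ReadingsShift` ∕ p228385)
variable {𝔾 : Type} [GaugeGroup 𝔾] (D : DrivenRuns 𝔾)
variable {oc : Type} [Fintype oc] [DecidableEq oc] (ιr : 𝔾 →* Matrix oc oc ℂ) (cc : ℂ) (ag : ℝ) (sg : ℕ → ℂ)
variable {T ι' Sy Ω 𝒴 : Type} [MeasurableSpace Ω] (Pm : MeasPotFrame D.carriers) {IOp : Type*} [NormedAddCommGroup IOp] [NormedSpace ℂ IOp]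
  (𝒵 : D.carriers.Dom → InnerLabel D.carriers.Dom (Bnd D.toTwoRuns) → Type) [∀ Z j, Fintype (𝒵 Z j)] (domZ : ∀ Z j, 𝒵 Z j → D.carriers.Dom)
  (Jc : D.carriers.Dom → InnerLabel D.carriers.Dom (Bnd D.toTwoRuns) → Type) [∀ Z j, Fintype (Jc Z j)]
  (Vv : D.carriers.Dom → InnerLabel D.carriers.Dom (Bnd D.toTwoRuns) → Type) [∀ Z j, NormedAddCommGroup (Vv Z j)]
  [∀ Z j, InnerProductSpace ℝ (Vv Z j)] [∀ Z j, MeasurableSpace (Vv Z j)] [∀ Z j, BorelSpace (Vv Z j)] [∀ Z j, FiniteDimensional ℝ (Vv Z j)]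
  (mI : D.carriers.Dom → InnerLabel D.carriers.Dom (Bnd D.toTwoRuns) → Type) [∀ Z j, Fintype (mI Z j)] [∀ Z j, DecidableEq (mI Z j)]
  (Lsl : SlotLetters D (o := oc) (T := T) (ι' := ι') (S := Sy) (Ω := Ω) (𝒴 := 𝒴) Pm (IOp := IOp) 𝒵 domZ Jc Vv mI)
-- node NE3 ∕ the owner's letters (sizes)
variable {d : ℕ} (L : ℕ) [NeZero L] (M : Fin d → ℕ) [hM : ∀ μ, NeZero (M μ)] (a : ℝ) (ha : 0 < a)
variable {o : Type*} [Fintype o] [DecidableEq o] {α β C a' η : ℝ} {m : Type*} [Fintype m] [DecidableEq m]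

/-- [folklore] **E8[rec] (STRUCTURAL SECANT END OF RECORD) AT THE SUBSTRATE's COV-SHIFTED O1 INSTANCE WITH W1 PRODUCED AT BAŁABAN's TIER-B BACKGROUND,
COVARIANCE READINGS WINDOWED** — `B13StepOfRecordSubstrateShift.ne5_of_substrateShift_restrict_secant_structural` at `S₀ := slotsOfRecordShift D ιr cc ag sg Pm 𝒵
domZ Jc Vv mI Lsl` (W-21) with its W1 binder `hwer` SUPPLIED BY NAME by substrate-p1's W-21b `weightedEntrywiseRate_slotsOfRecordShift_balaban_ne3Shape` (so U1b's
`NE3Shape` (OPEN), the class ∕ threshold letters and the owner's O1 letters AT THE SUBSTRATE's TABLES `hdec … hR` are displayed instead; run A read THROUGH THE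
TRANSPORTER, run B's raw record `rawBOfRecordShift D ιr …` with the covariance slot one level deeper, `hcovA ∕ hcovB` in g37-c's WINDOWED shapes
`ReadsTowerCovAOn ∕ ReadsTowerCovBOn {k : ℕ | k ≤ D.K}`), `hc₁ ∕ hθ0` discharged (p225077 §1), the W1 rate read as `√(max θ L⁻¹)` and the W1 constant as its
assembled size; EVERY OTHER binder VERBATIM at the two substitutions (renames `Φ ↦ Φc`, `hdec ↦ hdecAct`, `N ↦ Nl` only) — p228385 §1 with the shift
substitutions, nothing else.  Conclusion LITERALLY `T4OutputRate.NE5 (B13StepOfRecord.outA (slotsOfRecordShift …) E₀ cB) (B13StepOfRecord.outB (slotsOfRecordShift …)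
E₀ cB) W κ θ′ C₅` at the PRESCRIBED `θ′`, `C₅` = p214566's at the substitutions.  NOT a proof of NE5 ∕ NE2 ∕ NE3: an implication from displayed binders about
the substrate's letters; nothing of Bałaban's is asserted. -/
theorem ne5_of_substrateShift_restrict_secant_structural_balaban_ne3Shape (E₀ cB : ℝ)
    {𝒞 : ℕ → Set (B7Prop1Explicit.Site d → Fin d → (Matrix o o ℂ)ˣ)} {Nl : ℕ}
    {dom : Set (B7Prop1Explicit.Site d → Fin d → (Matrix o o ℂ)ˣ)} (hL : 2 ≤ L) (hd : 1 ≤ d)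
    {RgV : (B7Prop1Explicit.Site d → Fin d → (Matrix o o ℂ)ˣ) → ((k : ℕ) → Fin d → (Tor (fine (lev L k) M) → Matrix o o ℂ))}
    (hreg : ∀ V ∈ dom, RegularTransporters L M (liftR L M (RgV V)) α β) (hα : 0 ≤ α) (hβ : 0 ≤ β) (hC : 0 ≤ C) {θ : ℝ}
    (hNE3 : NE3Shape (minActReadings d 𝒞 L Nl dom (ne2Loc L M fun V => liftR L M (RgV V))) C θ)
    (ha' : 0 < a') (hαη : α ≤ η) (hβη : β ≤ η) (hη : η ≤ etaStar o d a a')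
    -- the towers over the two-run object's run-B backgrounds and the window
    {tow : ℕ → (ℕ → ℝ) → D.toTwoRuns.carriers.BgB → ↥dom} {W : Set (ℕ → ℝ)}
    -- the covariance species, read at the substrate's V1 operator entries — WINDOWED to run A's levels `k ≤ D.K` (g37-c ∕ W-21b), run B one level deeper
    {σ : T → ((Tor (unitMod (D.F.P D.K)) × Fin (D.F.P D.K).d) × oc) → idx L M 0 × o} {dist₁ : idx L M 0 × o → idx L M 0 × o → ℝ} {B₁ δ₁ : ℝ}
    (hdec : ∀ V ∈ dom, ∀ k, EntryDecay dist₁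
      (pertCovC L M a ha (balabanPert L M a (liftR L M (RgV V)) (gaugeSlot L M (RgV V) (QuT L M o (siteT L M (RgV V))) (Q1 L M o) a'))
        1 k) B₁ δ₁)
    (hcovA : ReadsTowerCovAOn {k : ℕ | k ≤ D.K}
      (fun V : ↥dom => pertCovC L M a ha
        (balabanPert L M a (liftR L M (RgV V)) (gaugeSlot L M (RgV V) (QuT L M o (siteT L M (RgV V))) (Q1 L M o) a')) 1)
      σ tow (fun g U k => (rawAOfRecord ιr D cc ag sg Lsl.ΓA Lsl.dkA Lsl.gcA Lsl.pQA Lsl.pRA) g (D.toTwoRuns.carriers.transport U) k) W)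
    (hcovB : ReadsTowerCovBOn {k : ℕ | k ≤ D.K}
      (fun V : ↥dom => pertCovC L M a ha
        (balabanPert L M a (liftR L M (RgV V)) (gaugeSlot L M (RgV V) (QuT L M o (siteT L M (RgV V))) (Q1 L M o) a')) 1)
      σ tow (rawBOfRecordShift D ιr cc ag sg Lsl.ΓB Lsl.dkB Lsl.gcB Lsl.pQB Lsl.pRB) W)
    (hdom₁ : CovWeightDominatesDist (slotsOfRecordShift D ιr cc ag sg Pm 𝒵 domZ Jc Vv mI Lsl).F dist₁ σ (δ₁ / 2))
    -- the `deltaKer` species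
    {S₂ : Set (Matrix (idx L M 0 × o) (idx L M 0 × o) ℂ)} {Φ : T → Matrix (idx L M 0 × o) (idx L M 0 × o) ℂ → Matrix m m ℂ}
    {Λ₂ : ℝ} (hΦ : ∀ t, OpLipschitzOn S₂ (Φ t) Λ₂) (hΛ₂ : 0 ≤ Λ₂)
    (hS₂ : ∀ V ∈ dom, ∀ k, pertCovC L M a ha
      (balabanPert L M a (liftR L M (RgV V)) (gaugeSlot L M (RgV V) (QuT L M o (siteT L M (RgV V))) (Q1 L M o) a')) 1 k ∈ S₂)
    {dist₂ : m → m → ℝ} {B₂ δ₂ : ℝ}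
    (hdecΦ : ∀ V ∈ dom, ∀ t k, EntryDecay dist₂ (Φ t (pertCovC L M a ha
      (balabanPert L M a (liftR L M (RgV V)) (gaugeSlot L M (RgV V) (QuT L M o (siteT L M (RgV V))) (Q1 L M o) a')) 1 k)) B₂ δ₂)
    {σX : T → ι' → m}
    (hΔA : ReadsTowerDeltaA (fun (V : ↥dom) t k => Φ t (pertCovC L M a ha
      (balabanPert L M a (liftR L M (RgV V)) (gaugeSlot L M (RgV V) (QuT L M o (siteT L M (RgV V))) (Q1 L M o) a')) 1 k))
      σX tow (fun g U k => (rawAOfRecord ιr D cc ag sg Lsl.ΓA Lsl.dkA Lsl.gcA Lsl.pQA Lsl.pRA) g (D.toTwoRuns.carriers.transport U) k) W)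
    (hΔB : ReadsTowerDeltaB (fun (V : ↥dom) t k => Φ t (pertCovC L M a ha
      (balabanPert L M a (liftR L M (RgV V)) (gaugeSlot L M (RgV V) (QuT L M o (siteT L M (RgV V))) (Q1 L M o) a')) 1 k))
      σX tow (rawBOfRecordShift D ιr cc ag sg Lsl.ΓB Lsl.dkB Lsl.gcB Lsl.pQB Lsl.pRB) W)
    (hdom₂ : DeltaWeightDominatesDist (slotsOfRecordShift D ιr cc ag sg Pm 𝒵 domZ Jc Vv mI Lsl).F dist₂ σX (δ₂ / 2))
    -- the `gammaConstituent` species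
    {S₃ : Set (Matrix (idx L M 0 × o) (idx L M 0 × o) ℂ)} {Ψ : T → Matrix (idx L M 0 × o) (idx L M 0 × o) ℂ → Matrix m m ℂ}
    {Λ₃ : ℝ} (hΨ : ∀ t, OpLipschitzOn S₃ (Ψ t) Λ₃) (hΛ₃ : 0 ≤ Λ₃)
    (hS₃ : ∀ V ∈ dom, ∀ k, pertCovC L M a ha
      (balabanPert L M a (liftR L M (RgV V)) (gaugeSlot L M (RgV V) (QuT L M o (siteT L M (RgV V))) (Q1 L M o) a')) 1 k ∈ S₃)
    {dist₃ : m → m → ℝ} {B₃ δ₃ : ℝ}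
    (hdecΨ : ∀ V ∈ dom, ∀ t k, EntryDecay dist₃ (Ψ t (pertCovC L M a ha
      (balabanPert L M a (liftR L M (RgV V)) (gaugeSlot L M (RgV V) (QuT L M o (siteT L M (RgV V))) (Q1 L M o) a')) 1 k)) B₃ δ₃)
    {σB : T → ((Tor (unitMod (D.F.P D.K)) × Fin (D.F.P D.K).d) × oc) → m}
    (hΓA : ReadsTowerGammaA (fun (V : ↥dom) t k => Ψ t (pertCovC L M a ha
      (balabanPert L M a (liftR L M (RgV V)) (gaugeSlot L M (RgV V) (QuT L M o (siteT L M (RgV V))) (Q1 L M o) a')) 1 k))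
      σB σX tow (fun g U k => (rawAOfRecord ιr D cc ag sg Lsl.ΓA Lsl.dkA Lsl.gcA Lsl.pQA Lsl.pRA) g (D.toTwoRuns.carriers.transport U) k) W)
    (hΓB : ReadsTowerGammaB (fun (V : ↥dom) t k => Ψ t (pertCovC L M a ha
      (balabanPert L M a (liftR L M (RgV V)) (gaugeSlot L M (RgV V) (QuT L M o (siteT L M (RgV V))) (Q1 L M o) a')) 1 k))
      σB σX tow (rawBOfRecordShift D ιr cc ag sg Lsl.ΓB Lsl.dkB Lsl.gcB Lsl.pQB Lsl.pRB) W)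
    (hdom₃ : GammaWeightDominatesDist (slotsOfRecordShift D ιr cc ag sg Pm 𝒵 domZ Jc Vv mI Lsl).F dist₃ σB σX (δ₃ / 2))
    -- the potential species
    {Λ₄ Λ₅ : ℝ} (hΛ₄ : 0 ≤ Λ₄) (hΛ₅ : 0 ≤ Λ₅)
    (hQ : PotQLipschitzReading (minActReadings d 𝒞 L Nl dom (ne2Loc L M fun V => liftR L M (RgV V))) (slotsOfRecordShift D ιr cc ag sg Pm 𝒵 domZ Jc Vv mI Lsl).F
      (fun g U k => (rawAOfRecord ιr D cc ag sg Lsl.ΓA Lsl.dkA Lsl.gcA Lsl.pQA Lsl.pRA) g (D.toTwoRuns.carriers.transport U) k)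
      (rawBOfRecordShift D ιr cc ag sg Lsl.ΓB Lsl.dkB Lsl.gcB Lsl.pQB Lsl.pRB) W Λ₄)
    (hR : PotRLipschitzReading (minActReadings d 𝒞 L Nl dom (ne2Loc L M fun V => liftR L M (RgV V))) (slotsOfRecordShift D ιr cc ag sg Pm 𝒵 domZ Jc Vv mI Lsl).F
      (fun g U k => (rawAOfRecord ιr D cc ag sg Lsl.ΓA Lsl.dkA Lsl.gcA Lsl.pQA Lsl.pRA) g (D.toTwoRuns.carriers.transport U) k)
      (rawBOfRecordShift D ιr cc ag sg Lsl.ΓB Lsl.dkB Lsl.gcB Lsl.pQB Lsl.pRB) W Λ₅)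
    {ROp RHist : ℕ → ℝ}
    {N A A' Aop Aop' : ℕ → (ℕ → ℝ) → D.toTwoRuns.carriers.BgB → D.toTwoRuns.carriers.Dom →
      InnerLabel D.toTwoRuns.carriers.Dom (Bnd D.toTwoRuns) → ℝ}
    {Dt : ActData D.toTwoRuns.carriers.Dom (InnerLabel D.toTwoRuns.carriers.Dom (Bnd D.toTwoRuns))
      (measOp T ((Tor (unitMod (D.F.P D.K)) × Fin (D.F.P D.K).d) × oc) ι' Ω 𝒴) (B13HistM Pm) Ω}
    {κ Nbar ε εop Rt EA₀ E₁ cA r₀ Gi δI ρ₁ θ' ρ₀ B : ℝ} {k₀ k₁ : ℕ} (rI : ℕ → ℝ) (hrI : ∀ k, 0 < rI k)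
    {Cfg : ℕ → Type*} [∀ k, NormedAddCommGroup (Cfg k)] [∀ k, NormedSpace ℂ (Cfg k)] {cfg : ∀ k, IOp → Cfg k}
    {Φc : ∀ k, (D.toTwoRuns.carriers.Dom → ℝ) → Cfg k → B13HistM Pm} {𝒪 : ℕ → (ℕ → ℝ) → D.toTwoRuns.carriers.BgB → Set IOp}
    {Dc : ∀ k, (ℕ → ℝ) → D.toTwoRuns.carriers.BgB → Set (Cfg k)}
    -- the Letters module's §1 letter conditions (the sub-slot memberships `hMA` ∕ `hMB`; `hbdB` about the SHIFTED raw record)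
    (hbdA : ∀ (g : ℕ → ℝ) (U : D.carriers.BgA) (k : ℕ),
      FormatBounded (Lsl.W k).format (rawAOfRecord ιr D cc ag sg Lsl.ΓA Lsl.dkA Lsl.gcA Lsl.pQA Lsl.pRA g U k).kernel)
    (hmQA : ∀ (r : ℝ) (U : GaugeField (D.F.P D.K) 0 𝔾) (k : ℕ) (Y : 𝒴) (b b' : ((Tor (unitMod (D.F.P D.K)) × Fin (D.F.P D.K).d) × oc)),
        Measurable fun x : Ω => Lsl.pQA r U k x Y b b')
    (hmRA : ∀ (r : ℝ) (U : GaugeField (D.F.P D.K) 0 𝔾) (k : ℕ) (Y : 𝒴), Measurable fun x : Ω => Lsl.pRA r U k x Y)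
    (hbdB : ∀ (g : ℕ → ℝ) (U : D.carriers.BgB) (k : ℕ),
      FormatBounded (Lsl.W k).format (rawBOfRecordShift D ιr cc ag sg Lsl.ΓB Lsl.dkB Lsl.gcB Lsl.pQB Lsl.pRB g U k).kernel)
    (hmQB : ∀ (r : ℝ) (U : GaugeField (D.F.P (D.K + 1)) 0 𝔾) (k : ℕ) (Y : 𝒴) (b b' : ((Tor (unitMod (D.F.P D.K)) × Fin (D.F.P D.K).d) × oc)),
        Measurable fun x : Ω => Lsl.pQB r U k x Y b b')
    (hmRB : ∀ (r : ℝ) (U : GaugeField (D.F.P (D.K + 1)) 0 𝔾) (k : ℕ) (Y : 𝒴), Measurable fun x : Ω => Lsl.pRB r U k x Y)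
    -- the Letters module's §2 factorisation datum (L01)
    (iopAt : ℝ → D.carriers.BgA → ℕ → IOp)
    (hiopA : ∀ (r : ℝ) (U : D.carriers.BgB) (k : ℕ), Lsl.ins.iopA r U k = iopAt r (D.carriers.transport U) k)
    -- `B13StepOfRecordSubstrateShift` §1's remaining binders VERBATIM (W1 `hwer`, `hc₁`, `hθ0` GONE — produced below)
    (hbB : (assembly (slotsOfRecordShift D ιr cc ag sg Pm 𝒵 domZ Jc Vv mI Lsl)).SliceBudgetB W κ cB)
    (hbA : (slotsOfRecordShift D ιr cc ag sg Pm 𝒵 domZ Jc Vv mI Lsl).D.SliceBudget (step (slotsOfRecordShift D ιr cc ag sg Pm 𝒵 domZ Jc Vv mI Lsl) E₀ cB) W κ cA)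
    (hdA : DecayBound (B13StepOfRecord.outA (slotsOfRecordShift D ιr cc ag sg Pm 𝒵 domZ Jc Vv mI Lsl) E₀ cB) W EA₀ κ)
    (hdB : DecayBound (B13StepOfRecord.outB (slotsOfRecordShift D ιr cc ag sg Pm 𝒵 domZ Jc Vv mI Lsl) E₀ cB) W E₀ κ)
    (hRA : RawBounded (slotsOfRecordShift D ιr cc ag sg Pm 𝒵 domZ Jc Vv mI Lsl).F (assembly (slotsOfRecordShift D ιr cc ag sg Pm 𝒵 domZ Jc Vv mI Lsl)).rawAt W)
    (hRB : RawBounded (slotsOfRecordShift D ιr cc ag sg Pm 𝒵 domZ Jc Vv mI Lsl).F (slotsOfRecordShift D ιr cc ag sg Pm 𝒵 domZ Jc Vv mI Lsl).rawB W) (hfl : ∀ k, r₀ ≤ Lsl.rOp k)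
    (hcomp : InsOpComposition ((slotsOfRecordShift D ιr cc ag sg Pm 𝒵 domZ Jc Vv mI Lsl).D.toInsOpModel (step (slotsOfRecordShift D ιr cc ag sg Pm 𝒵 domZ Jc Vv mI Lsl) E₀ cB)
      rI hrI)
      W κ E₀ Gi cfg Φc 𝒪 Dc)
    (hIA : ∀ k, ∀ g ∈ W, ∀ (U : D.toTwoRuns.carriers.BgB),
      ((slotsOfRecordShift D ιr cc ag sg Pm 𝒵 domZ Jc Vv mI Lsl).D.toInsOpModel (step (slotsOfRecordShift D ιr cc ag sg Pm 𝒵 domZ Jc Vv mI Lsl) E₀ cB)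
        rI hrI).opIA g U k ∈ 𝒪 k g U)
    (hirate : ((slotsOfRecordShift D ιr cc ag sg Pm 𝒵 domZ Jc Vv mI Lsl).D.toInsOpModel (step (slotsOfRecordShift D ιr cc ag sg Pm 𝒵 domZ Jc Vv mI Lsl) E₀ cB)
      rI hrI).InsOpRate W δI (Real.sqrt (max θ ((L : ℝ)⁻¹))))
    (hδI : 0 ≤ δI) (hGi : 0 ≤ Gi) (hρ₁ : ρ₁ < 1) (hreachI : δI * Real.sqrt (max θ ((L : ℝ)⁻¹)) ^ k₁ ≤ ρ₁)
    (hfib : ActOpFibre (labelsIndexing (domainGeometry D.toTwoRuns) (b13InnerData D.toTwoRuns))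
      (restrict (slotsOfRecordShift D ιr cc ag sg Pm 𝒵 domZ Jc Vv mI Lsl) (measOp T ((Tor (unitMod (D.F.P D.K)) × Fin (D.F.P D.K).d) × oc) ι' Ω 𝒴)
          (opA_mem_measOp_slotsOfRecordShift D ιr cc ag sg Pm 𝒵 domZ Jc Vv mI Lsl hbdA hmQA hmRA)
        (opB_mem_measOp_slotsOfRecordShift D ιr cc ag sg Pm 𝒵 domZ Jc Vv mI Lsl hbdB hmQB hmRB)).act
      (stepOn (restrict (slotsOfRecordShift D ιr cc ag sg Pm 𝒵 domZ Jc Vv mI Lsl) (measOp T ((Tor (unitMod (D.F.P D.K)) × Fin (D.F.P D.K).d) × oc) ι' Ω 𝒴)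
          (opA_mem_measOp_slotsOfRecordShift D ιr cc ag sg Pm 𝒵 domZ Jc Vv mI Lsl hbdA hmQA hmRA)
        (opB_mem_measOp_slotsOfRecordShift D ιr cc ag sg Pm 𝒵 domZ Jc Vv mI Lsl hbdB hmQB hmRB)) E₀ cB) W Aop)
    (hAop0 : ∀ k g U Z ℓ, 0 ≤ Aop k g U Z ℓ) (hAop0' : ∀ k g U Z ℓ, 0 ≤ Aop' k g U Z ℓ)
    (hdecop : ∀ k g U Z ℓ, Aop k g U Z ℓ ≤ Aop' k g U Z ℓ * Real.exp (-(κ * (D.toTwoRuns.carriers.d Z + 5)))) (hεop : 0 ≤ εop)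
    (h238op : ∀ k, ∀ g ∈ W, ∀ (U : D.toTwoRuns.carriers.BgB), ∀ Z ∈ D.toTwoRuns.domAt k,
      actSum (b13InnerData D.toTwoRuns) (Aop' k g U) k Z ≤ εop * Real.exp (-(Rt * D.toTwoRuns.carriers.d Z)))
    (hΦopsmall : 36 * (εop * Real.exp 64 * B12TreeDecay.K₀ (4 * 2 ^ 4) (2 * 4)) < 1)
    (hexp : ActExpLinearOn (labelsIndexing (domainGeometry D.toTwoRuns) (b13InnerData D.toTwoRuns))
      (restrict (slotsOfRecordShift D ιr cc ag sg Pm 𝒵 domZ Jc Vv mI Lsl) (measOp T ((Tor (unitMod (D.F.P D.K)) × Fin (D.F.P D.K).d) × oc) ι' Ω 𝒴)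
          (opA_mem_measOp_slotsOfRecordShift D ιr cc ag sg Pm 𝒵 domZ Jc Vv mI Lsl hbdA hmQA hmRA)
        (opB_mem_measOp_slotsOfRecordShift D ιr cc ag sg Pm 𝒵 domZ Jc Vv mI Lsl hbdB hmQB hmRB)).act Dt
      (ballClass (selfCtr
        (assemblyOn (restrict (slotsOfRecordShift D ιr cc ag sg Pm 𝒵 domZ Jc Vv mI Lsl) (measOp T ((Tor (unitMod (D.F.P D.K)) × Fin (D.F.P D.K).d) × oc) ι' Ω 𝒴)
            (opA_mem_measOp_slotsOfRecordShift D ιr cc ag sg Pm 𝒵 domZ Jc Vv mI Lsl hbdA hmQA hmRA)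
          (opB_mem_measOp_slotsOfRecordShift D ιr cc ag sg Pm 𝒵 domZ Jc Vv mI Lsl hbdB hmQB hmRB))).raw
        (assemblyOn (restrict (slotsOfRecordShift D ιr cc ag sg Pm 𝒵 domZ Jc Vv mI Lsl) (measOp T ((Tor (unitMod (D.F.P D.K)) × Fin (D.F.P D.K).d) × oc) ι' Ω 𝒴)
            (opA_mem_measOp_slotsOfRecordShift D ιr cc ag sg Pm 𝒵 domZ Jc Vv mI Lsl hbdA hmQA hmRA)
          (opB_mem_measOp_slotsOfRecordShift D ιr cc ag sg Pm 𝒵 domZ Jc Vv mI Lsl hbdB hmQB hmRB))).histRef) ROp RHist) W)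
    (hN : ActExpNormBound (labelsIndexing (domainGeometry D.toTwoRuns) (b13InnerData D.toTwoRuns)) Dt
      (ballClass (selfCtr
        (assemblyOn (restrict (slotsOfRecordShift D ιr cc ag sg Pm 𝒵 domZ Jc Vv mI Lsl) (measOp T ((Tor (unitMod (D.F.P D.K)) × Fin (D.F.P D.K).d) × oc) ι' Ω 𝒴)
            (opA_mem_measOp_slotsOfRecordShift D ιr cc ag sg Pm 𝒵 domZ Jc Vv mI Lsl hbdA hmQA hmRA)
          (opB_mem_measOp_slotsOfRecordShift D ιr cc ag sg Pm 𝒵 domZ Jc Vv mI Lsl hbdB hmQB hmRB))).raw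
        (assemblyOn (restrict (slotsOfRecordShift D ιr cc ag sg Pm 𝒵 domZ Jc Vv mI Lsl) (measOp T ((Tor (unitMod (D.F.P D.K)) × Fin (D.F.P D.K).d) × oc) ι' Ω 𝒴)
            (opA_mem_measOp_slotsOfRecordShift D ιr cc ag sg Pm 𝒵 domZ Jc Vv mI Lsl hbdA hmQA hmRA)
          (opB_mem_measOp_slotsOfRecordShift D ιr cc ag sg Pm 𝒵 domZ Jc Vv mI Lsl hbdB hmQB hmRB))).histRef) ROp RHist) W
      Lsl.rHist N)
    (hN0 : ∀ k g U Z ℓ, 0 ≤ N k g U Z ℓ) (hNle : ∀ k g U Z ℓ, N k g U Z ℓ ≤ Nbar) (hNbar : 0 ≤ Nbar)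
    (habs : ActAbsBound (labelsIndexing (domainGeometry D.toTwoRuns) (b13InnerData D.toTwoRuns)) Dt
      (ballClass (selfCtr
        (assemblyOn (restrict (slotsOfRecordShift D ιr cc ag sg Pm 𝒵 domZ Jc Vv mI Lsl) (measOp T ((Tor (unitMod (D.F.P D.K)) × Fin (D.F.P D.K).d) × oc) ι' Ω 𝒴)
            (opA_mem_measOp_slotsOfRecordShift D ιr cc ag sg Pm 𝒵 domZ Jc Vv mI Lsl hbdA hmQA hmRA)
          (opB_mem_measOp_slotsOfRecordShift D ιr cc ag sg Pm 𝒵 domZ Jc Vv mI Lsl hbdB hmQB hmRB))).raw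
        (assemblyOn (restrict (slotsOfRecordShift D ιr cc ag sg Pm 𝒵 domZ Jc Vv mI Lsl) (measOp T ((Tor (unitMod (D.F.P D.K)) × Fin (D.F.P D.K).d) × oc) ι' Ω 𝒴)
            (opA_mem_measOp_slotsOfRecordShift D ιr cc ag sg Pm 𝒵 domZ Jc Vv mI Lsl hbdA hmQA hmRA)
          (opB_mem_measOp_slotsOfRecordShift D ιr cc ag sg Pm 𝒵 domZ Jc Vv mI Lsl hbdB hmQB hmRB))).histRef) ROp RHist) W A)
    (hA0 : ∀ k g U Z ℓ, 0 ≤ A k g U Z ℓ) (hA0' : ∀ k g U Z ℓ, 0 ≤ A' k g U Z ℓ) (hκ : 0 ≤ κ)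
    (hdecAct : ∀ k g U Z ℓ, A k g U Z ℓ ≤ A' k g U Z ℓ * Real.exp (-(κ * (D.toTwoRuns.carriers.d Z + 5))))
    (hε : 0 ≤ ε)
    (h238 : ∀ k, ∀ g ∈ W, ∀ (U : D.toTwoRuns.carriers.BgB), ∀ Z ∈ D.toTwoRuns.domAt k,
      actSum (b13InnerData D.toTwoRuns) (A' k g U) k Z ≤ ε * Real.exp (-(Rt * D.toTwoRuns.carriers.d Z)))
    (hRt : 64 * Real.log 162 + 64 ≤ Rt) (hΦsmall : 36 * (ε * Real.exp 64 * B12TreeDecay.K₀ (4 * 2 ^ 4) (2 * 4)) < 1)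
    (hOp : ∀ k, (Real.sqrt (2 * B₁ * (2 * CpertRec o d L a α β C a' / (1 - max θ ((L : ℝ)⁻¹)))) +
          Real.sqrt (2 * B₂ * (Λ₂ * CpertRec o d L a α β C a')) + Real.sqrt (2 * B₃ * (Λ₃ * CpertRec o d L a α β C a')) +
          Λ₄ * C + Λ₅ * C) / r₀ * Lsl.rOp k ≤ ROp k) (hHist : ∀ k, (assembly (slotsOfRecordShift D ιr cc ag sg Pm 𝒵 domZ Jc Vv mI Lsl)).bHist E₀ cB k ≤ RHist k)
    (hHistA : ∀ k, (Gi * δI / (1 - ρ₁) + 2 * Gi / Real.sqrt (max θ ((L : ℝ)⁻¹)) ^ k₁) * Lsl.rHist k + EA₀ * (Lsl.rHist k * (cA / (1 - Lsl.ins.ω))) ≤ RHist k)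
    (hEA₀ : 0 ≤ EA₀) (hE₀ : 0 ≤ E₀) (hE₁ : 0 < E₁) (hcA : 0 ≤ cA) (hcB : 0 ≤ cB)
    (hr₀ : 0 < r₀) (hθθ' : Real.sqrt (max θ ((L : ℝ)⁻¹)) ≤ θ') (hθ'1 : θ' ≤ 1) (hω : 0 < Lsl.ins.ω)
    (hω1 : Lsl.ins.ω < 1) (hρ₀ : 0 ≤ ρ₀) (hρ₀1 : ρ₀ < 1) (hreach : (Real.sqrt (2 * B₁ * (2 * CpertRec o d L a α β C a' / (1 - max θ ((L : ℝ)⁻¹)))) +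
          Real.sqrt (2 * B₂ * (Λ₂ * CpertRec o d L a α β C a')) + Real.sqrt (2 * B₃ * (Λ₃ * CpertRec o d L a α β C a')) +
          Λ₄ * C + Λ₅ * C) / r₀ * Real.sqrt (max θ ((L : ℝ)⁻¹)) ^ k₀ ≤ ρ₀) (hB : 0 ≤ B)
    (hfirst : ∀ k < k₀, EA₀ + E₀ ≤ B * Real.sqrt (max θ ((L : ℝ)⁻¹)) ^ k)
    (hsmall : Lsl.ins.ω + 2 * (Nbar * ((ε * Real.exp 64 * B12TreeDecay.K₀ (4 * 2 ^ 4) (2 * 4)) /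
          (1 - 36 * (ε * Real.exp 64 * B12TreeDecay.K₀ (4 * 2 ^ 4) (2 * 4))) ^ 2)) * cA < θ') :
    NE5 (B13StepOfRecord.outA (slotsOfRecordShift D ιr cc ag sg Pm 𝒵 domZ Jc Vv mI Lsl) E₀ cB)
      (B13StepOfRecord.outB (slotsOfRecordShift D ιr cc ag sg Pm 𝒵 domZ Jc Vv mI Lsl) E₀ cB) W κ θ'
      (((1 / (1 - ρ₀) * ((εop * Real.exp 64 * B12TreeDecay.K₀ (4 * 2 ^ 4) (2 * 4)) /
          (1 - 36 * (εop * Real.exp 64 * B12TreeDecay.K₀ (4 * 2 ^ 4) (2 * 4))) ^ 2)) * ((Real.sqrt (2 * B₁ * (2 * CpertRec o d L a α β C a' / (1 - max θ ((L : ℝ)⁻¹)))) +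
          Real.sqrt (2 * B₂ * (Λ₂ * CpertRec o d L a α β C a')) + Real.sqrt (2 * B₃ * (Λ₃ * CpertRec o d L a α β C a')) +
          Λ₄ * C + Λ₅ * C) / r₀) +
        2 * (Nbar * ((ε * Real.exp 64 * B12TreeDecay.K₀ (4 * 2 ^ 4) (2 * 4)) /
          (1 - 36 * (ε * Real.exp 64 * B12TreeDecay.K₀ (4 * 2 ^ 4) (2 * 4))) ^ 2)) *
          (Gi * δI / (1 - ρ₁) + 2 * Gi / Real.sqrt (max θ ((L : ℝ)⁻¹)) ^ k₁) + B) * (θ' - Lsl.ins.ω) /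
        (θ' - (Lsl.ins.ω + 2 * (Nbar * ((ε * Real.exp 64 * B12TreeDecay.K₀ (4 * 2 ^ 4) (2 * 4)) /
          (1 - 36 * (ε * Real.exp 64 * B12TreeDecay.K₀ (4 * 2 ^ 4) (2 * 4))) ^ 2)) * cA))) :=
  ne5_of_substrateShift_restrict_secant_structural D ιr cc ag sg Pm 𝒵 domZ Jc Vv mI Lsl E₀ cB rI hrI hbdA hmQA hmRA hbdB hmQB hmRB iopAt hiopA
    hbB hbA hdA hdB hRA hRB
    (weightedEntrywiseRate_slotsOfRecordShift_balaban_ne3Shape D ιr cc ag sg Pm 𝒵 domZ Jc Vv mI Lsl L M a ha hL hd hreg hα hβ hC hNE3 ha' hαη hβη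
      hη hdec hcovA hcovB hdom₁ hΦ hΛ₂ hS₂ hdecΦ hΔA hΔB hdom₂ hΨ hΛ₃ hS₃ hdecΨ hΓA hΓB hdom₃ hΛ₄ hΛ₅ hQ hR)
    hfl hcomp hIA hirate hδI hGi hρ₁ hreachI hfib hAop0 hAop0' hdecop hεop h238op hΦopsmall hexp hN hN0 hNle hNbar habs hA0 hA0' hκ hdecAct hε
    h238 hRt hΦsmall hOp hHist hHistA hEA₀ hE₀ hE₁ hcA hcB (c1_balaban_nonneg L a hC hΛ₄ hΛ₅) hr₀
    (sqrt_rate_pos_lt_one L hL hNE3.rate_lt_one).1 hθθ' hθ'1 hω hω1 hρ₀ hρ₀1 hreach hB hfirst hsmall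

end Instance

end Summit.QuantumFields.BalabanUV.T4Continuum.B13StepOfRecordSubstrateShiftBalaban

end
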